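import Summits.QuantumFields.YangMills.Theorems.BalabanUVNodesN20KeyedRelWeightOverCut
import Summits.QuantumFields.BalabanUV.T4Continuum.Spine.NE7.Targets

/-!
# BalabanUVNodes ∕ N20 — THE OFF-LIVE ONE-TERM READING: at the index `ι := Unit` (ONE class per cutoff — the run's whole dressed partition function), `Bad := ∅`,
# zero shells, zero weights, the four K5 faces of K3⁷ v3 stub 2 hold OUTRIGHT but for the N19′ core, which IS node U5's TARGET at the datum — matching of
# consecutive dressed partition functions modulo `t`-independent constants with a summable remainder (dag-n20-c's observation, pub-ymgap INBOX l.26799; GO l.27216)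

Cell `pub-ymgap` (HUMAN RULING D-0062 Track A; work-bound push D-0149, director-ym №197), width seat `pub-ymgap-dag-n20-w1` (gen 3) on node N20 = NE7b; key item K3⁷
`SpineGivenEndpointR13SepCoPH` = stmt-QuantumFields-20544; filed `--kind definition --supports stmt-QuantumFields-20544 --as helper` (definition lane by content: TWO `def`s,
a carrier bundle and a reading); COUNT-NEUTRAL.  Bus: INTENT-7 (INBOX l.27458); dag-n20-c g17's hand GO-W1-ONETERM (l.27216) with its two asks = §1 and §1∕§3 below.

WHY.  K3⁷ v3's stub 2 (plan g81, 02f6f498332fdbee) pins the spine reading `cr` to dag-n20-d's reading of record ONLY ON THE LIVE-SELECTOR LINE (`PinnedAtLive jc sh cr`: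
`LiveSel F θ → cr … = crOfRecord₁₃V (jc …) sh …`); OFF that line `cr` is FREE, and dag-n27-c's (t-JC) leaf `…N27SpineGivenEndpointR13SepCoPHSpineReadingOfRecordVCut`
(p-landed, route-facing — NOT imported here) displays leaf D's four binders `h20' ∕ h21' ∕ hx' ∕ h19'` at an arbitrary off-live reading `cr'`.  dag-n20-c observed (l.26799)
that the free branch admits the ONE-TERM reading — one class per cutoff carrying the run's whole dressed partition function `Z_{K₀+K}(t) = schemeZ (D.scheme g₀) os (K₀+K) t`,
no bad class, no shells — under which extraction is `Finset.sum` over a singleton, NE7b and NE7c are the zero witnesses, and the N19′ core `e^{c_K − vol·δ_K}·Z_{K₀+K} ≤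
Z_{K₀+K+1} ≤ e^{c_K + vol·δ_K}·Z_{K₀+K}` on `|t| ≤ l₀` with `Σ δ < ∞` IS node U5's TARGET `Spine.NE7.Target vol l₀ δ (Z ∘ (K₀ + ·))` — CONTENT (NE7 ∕ [LF-II] Thm 1-strength
matching of consecutive cutoffs at the datum), not junk, and not cheaper than the keyed road (no class may be discarded).  THIS FILE TYPES THAT READING:
* §1 `cr`-FREE, ANY `Z : ℕ → ℝ → ℝ` (ask (1)): the one-term carriers as explicit lambdas (`T := univ : Finset Unit`, `A K t _ := Z (K₀+K) t`, `B K t _ := Z (K₀+K+1) t`,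
  `Bad := ∅`, shells `0`, `W = Wsh := 0`); E1∕E2 by `Fintype.sum_unique`; `RelWeightBound` and `ShellWeightBound` (given `0 ≤ Z`) OUTRIGHT; ★★ `core_oneTerm_iff_matchingModConstants`
  (ask (2)): for positive `Z`, `NE7.Core` on the singleton class ⟺ `T4CauchySum.MatchingModConstants vol l₀ δ (fun K ↦ Z (K₀+K))` — both directions, a log∕exp identity
  (`Spine.NE7.Targets.sandwich_of_abs_log_sub_le` and its converse); ★★ `hybridNE7_oneTerm_iff_target`: the one-term `T4MatchingAssembly.HybridNE7` ⟺ `Spine.NE7.Target` with the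
  SAME remainder `δ` (the tree's `target_of_hybridNE7` ∕ `HybridNE7.matchingModConstants` give «⇒» with `hybridDelta vol δ 0`); `stringHybridNE7_of_target`: per string, node U5's
  target from `K₀` on IS a `StringHybridNE7` datum (the converse of `T4MatchingAssembly.matchingModConstants_schemeZ` up to the remainder's name).
* §2 AS A CARRIER BUNDLE `oneTermCarriers l₀ vol K₀ Z : SpineCarriers` (`δ := 0` displayed and unread by the faces) with its `rfl` dictionary and the four faces.
* §3 THE READING `crOneTerm₁₃ K₀ : SpineReading₁₃CoPH N` — at EVERY Stage-13 tuple with core provisos the one-term bundle of the tuple's OWN dressed partition functions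
  `schemeZ ((datumOfRecord₁₃CoPH F N θ hP).scheme g₀) os` at `l₀ := 1`, `vol := F.side ^ 4`: extraction (`hx'`) at every `g₀` WITHOUT any selector pin or (H-U)∕(H-ζ) law,
  `RelWeightBound` (`h20'`) outright, `ShellWeightBound` (`h21'`) from `schemeZ_pos_datumOfRecord₁₃CoPH`, and ★★ `core_crOneTerm₁₃_iff_target`: the core face's conclusion ⟺
  `∃ δ, Target (F.side^4) 1 δ (fun K ↦ schemeZ … (K₀+K))`.
* §4 dag-n27-c's VCut OFF-LIVE BINDERS at `cr' := crOneTerm₁₃ K₀`, in their exact shapes (`N = 2`, guard ∧ `¬ LiveSel`): `h20' ∕ h21' ∕ hx'` for free, `h19'` from ONE displayed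
  input — «the rates imply node U5's target at the datum» on the off-live guarded admissible tuples.
Cited BY NAME, nothing re-typed: `T4WeightBudget.RelWeightBound`, `T4IndicatorShell.ShellWeightBound`, `T4MatchingAssembly.{HybridNE7, StringHybridNE7, shellWeightBound_zero,
hybridNE7_of_relWeightBound}`, `T4CauchySum.MatchingModConstants`, `Spine.NE7.Targets.{Core, Target, sandwich_of_abs_log_sub_le}`, `YMDAG.UVSplit.SpineCarriers ∕
SpineReading₁₃CoPH`, `…N20AtRecord13CoPH.schemeZ_pos_datumOfRecord₁₃CoPH`, `ForSmallCouplings.of_forall`.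

HONEST FRAMING.  A DEFINITION of a reading + [folklore] log∕exp and singleton-sum bookkeeping; NO estimate.  The one-term reading books NO class decomposition: at it the
hybrid split degenerates and NE7 ∕ NE7b ∕ NE7c collapse into node U5's TARGET at the datum, which is NOT PRINTED for `d = 4` ([LF-II] Thm 1 p.355 is ultraviolet stability,
not matching of consecutive cutoffs) and NOT proved — every `h19'`-type statement below takes it as a DISPLAYED hypothesis (A6: LOCATED; inhabited for no family today).
Whether off-live guarded admissible tuples exist (or get excluded by the (w18) proviso edition `… ∧ LiveSel`) is not decided here.  Nothing of Bałaban's is asserted; N19 ∕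
N20 ∕ N21 ∕ N27 NOT discharged; K3⁷ NOT closed; counts unmoved (typed 28∕28 · discharged 5∕27); no count claim.  One finite `𝕋⁴_{L^K}` programme at fixed `ε = L^{−K}` along
`K → ∞`, Bałaban AS PRINTED; the YM mass gap (Clay) is NOT proved by any of this — R4 closes the conditional finite-𝕋⁴ rung `BalabanLadder.UV` only; NOT ℝ⁴, NOT OS.  No
`instance`, no `notation`, no `sorry`.  Sources (bookkeeping): [Balaban1989LargeFieldII] Thm 1 + (0.1) pp.355–356; [Balaban1989LargeFieldI] (0.2)–(0.4) p.176;
[Balaban1985UV3] (6) p.257; [King1986] (3.10)–(3.11) p.656.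
v1.1 (APPEND-ONLY, HEADER-ONLY — every declaration byte-identical to v1.0 p598780).  PRIOR ART THIS SEAT MISSED AT INTENT TIME, recorded for the reader: the DEGENERATE ONE-CLASS
EXPANSION at the SCHEME ∕ DATUM level is dag-n23-b's `Literature/…/Balaban1983to89/T4MatchingDegenerate.lean` — `stringHybridNE7_of_matchingModConstants` (= §1's
`stringHybridNE7_of_target` in substance: there the positivity of the dressed partition functions is DISCHARGED from `β_K ≥ 0` and `1`-bounded measurable observables, here it is
displayed as `hZ`), `stringwiseHybridNE7_iff_stringwiseMatching`, `hybridNE7Under_iff_matchingUnder` (binder B5 ⟺ node U5's `T4ApexVariance.MatchingUnder`); and AT NODE 00's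
Stage-13 record dag-n19-d's `Thm/BalabanUVNodesN19TargetAtRecord13CoPH` §1 (`hybridNE7Under_iff_matchingUnder_of_isRecordOfRecord₁₃CCoPH`, the θ-keyed datum form) already reads
«B5 ⟺ `MatchingUnder D END`».  WHAT IS NEW HERE is only the packaging those files do not carry: the one-term bundle as a `YMDAG.UVSplit.SpineCarriers` value and as a
`SpineReading₁₃CoPH N` (`oneTermCarriers`, `crOneTerm₁₃`) — i.e. at leaf D's ∕ K3⁷ v3's `cr` slot OFF the live line —, the displayed `NE7.Core ↔ MatchingModConstants` and
`HybridNE7 ↔ Spine.NE7.Target` lemmas at that index with the SAME remainder, and dag-n27-c's VCut off-live binders at `cr' := crOneTerm₁₃ K₀` (§4).  Cite the three files above for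
the scheme ∕ datum ∕ record-level equivalences; nothing of theirs is restated as new.
-/

noncomputable section

open scoped BigOperators

namespace Summit.QuantumFields.YangMills.BalabanUVNodes.N20OffLiveOneTermReading

open Literature.MathematicalPhysics.QuantumFieldTheory.Balaban1983to89 Literature.MathematicalPhysics.QuantumFieldTheory.Balaban1983to89.Node00
open T4Continuum Summit.QuantumFields.BalabanUV.T4Continuum.Spine
open T4WeightBudget (RelWeightBound)
open T4IndicatorShell (ShellWeightBound)
open T4MatchingAssembly (HybridNE7 StringHybridNE7 shellWeightBound_zero hybridNE7_of_relWeightBound)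
open T4CauchySum (MatchingModConstants)
open T4ContinuumYM4Torus (ForSmallCouplings)
open NE7 (Target sandwich_of_abs_log_sub_le)
open YMDAG.UVSplit hiding SU
open Summit.QuantumFields.YangMills.Theorems.N20AtRecord13 (schemeZ_pos_datumOfRecord₁₃CoPH)

/-! ## §1  `cr`-free: the one-term carriers of ANY `Z : ℕ → ℝ → ℝ` at offset `K₀` -/

section Generic

variable (l₀ vol : ℝ) (K₀ : ℕ) (Z : ℕ → ℝ → ℝ)

/-- **E1 AT THE ONE-TERM INDEX**: `Z (K₀+K) t = Σ_{u ∈ univ} Z (K₀+K) t` over `Unit` (`Fintype.sum_unique`). [bookkeeping] -/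
theorem oneTerm_E1 (K : ℕ) (t : ℝ) : Z (K₀ + K) t = ∑ _u ∈ (Finset.univ : Finset Unit), Z (K₀ + K) t :=
  (Fintype.sum_unique fun _ : Unit => Z (K₀ + K) t).symm

/-- **E2 AT THE ONE-TERM INDEX**. [bookkeeping] -/
theorem oneTerm_E2 (K : ℕ) (t : ℝ) : Z (K₀ + K + 1) t = ∑ _u ∈ (Finset.univ : Finset Unit), Z (K₀ + K + 1) t :=
  (Fintype.sum_unique fun _ : Unit => Z (K₀ + K + 1) t).symm

/-- **NE7b AT THE ONE-TERM INDEX IS THE ZERO WITNESS**: no bad class, relative weight `0` — for ANY `Z`, any radius. [bookkeeping] -/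
theorem relWeightBound_oneTerm :
    RelWeightBound l₀ (fun _ => (Finset.univ : Finset Unit)) (fun K t _ => Z (K₀ + K) t) (fun K t _ => Z (K₀ + K + 1) t) (fun _ _ => ∅) (fun _ => 0) where
  bad_subset _ _ _ := Finset.empty_subset _
  nonneg _ := le_rfl
  lt_one _ := zero_lt_one
  summable := summable_zero
  bad_left _ _ _ := by rw [Finset.sum_empty, zero_mul]
  bad_right _ _ _ := by rw [Finset.sum_empty, zero_mul]

/-- **NE7c AT THE ONE-TERM INDEX IS THE ZERO WITNESS** given `0 ≤ Z` on the radius (`T4MatchingAssembly.shellWeightBound_zero`). [bookkeeping] -/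
theorem shellWeightBound_oneTerm (hZ : ∀ (K : ℕ) (t : ℝ), |t| ≤ l₀ → 0 ≤ Z K t) :
    ShellWeightBound l₀ (fun _ => (Finset.univ : Finset Unit)) (fun K t _ => Z (K₀ + K) t) (fun K t _ => Z (K₀ + K + 1) t) (fun _ _ _ => 0) (fun _ _ _ => 0)
      (fun _ => 0) :=
  shellWeightBound_zero (fun K t ht _ _ => hZ (K₀ + K) t ht) (fun K t ht _ _ => hZ (K₀ + K + 1) t ht)

/-- **THE CORE AT THE ONE-TERM INDEX, UNFOLDED**: `NE7.Core` with the empty bad class and zero shells reads, cutoff by cutoff, the two-sided matching of the consecutive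
partition functions `e^{c − vol·δ K}·Z (K₀+K) t ≤ Z (K₀+K+1) t ≤ e^{c + vol·δ K}·Z (K₀+K) t` on `|t| ≤ l₀` with a `t`-independent constant. [bookkeeping] -/
theorem core_oneTerm_iff (δ : ℕ → ℝ) :
    NE7.Core l₀ vol (fun _ => (Finset.univ : Finset Unit)) (fun _ _ => ∅) (fun K t _ => Z (K₀ + K) t - 0) (fun K t _ => Z (K₀ + K + 1) t - 0) δ ↔
      ∀ K : ℕ, ∃ c : ℝ, ∀ t : ℝ, |t| ≤ l₀ →
        Real.exp (c - vol * δ K) * Z (K₀ + K) t ≤ Z (K₀ + K + 1) t ∧ Z (K₀ + K + 1) t ≤ Real.exp (c + vol * δ K) * Z (K₀ + K) t := by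
  simp only [NE7.Core, sub_zero, Finset.sdiff_empty, Finset.mem_univ, forall_const]

/-- The converse of `Spine.NE7.Targets.sandwich_of_abs_log_sub_le`: a two-sided multiplicative sandwich of positive reals is a bound on the difference of logarithms.
[bookkeeping] -/
theorem abs_log_sub_le_of_sandwich {P Q c η : ℝ} (hP : 0 < P) (h : Real.exp (c - η) * P ≤ Q ∧ Q ≤ Real.exp (c + η) * P) :
    |Real.log Q - Real.log P - c| ≤ η := by
  have hQ : 0 < Q := lt_of_lt_of_le (mul_pos (Real.exp_pos _) hP) h.1
  rw [abs_le]
  constructor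
  · have h1 := Real.log_le_log (mul_pos (Real.exp_pos _) hP) h.1
    rw [Real.log_mul (Real.exp_pos _).ne' hP.ne', Real.log_exp] at h1
    linarith
  · have h2 := Real.log_le_log hQ h.2
    rw [Real.log_mul (Real.exp_pos _).ne' hP.ne', Real.log_exp] at h2
    linarith

/-- ★★ **THE SURVIVING CONJUNCT IS NODE U5's MATCHING MODULO CONSTANTS** (dag-n20-c's ask (2)): for `Z` POSITIVE on the radius, `NE7.Core` at the one-term index ⟺
`T4CauchySum.MatchingModConstants vol l₀ δ (fun K ↦ Z (K₀ + K))` — `|log Z_{K₀+K+1}(t) − log Z_{K₀+K}(t) − c_K| ≤ vol·δ_K` on `|t| ≤ l₀`; both directions. [bookkeeping] -/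
theorem core_oneTerm_iff_matchingModConstants (δ : ℕ → ℝ) (hZ : ∀ (K : ℕ) (t : ℝ), |t| ≤ l₀ → 0 < Z K t) :
    NE7.Core l₀ vol (fun _ => (Finset.univ : Finset Unit)) (fun _ _ => ∅) (fun K t _ => Z (K₀ + K) t - 0) (fun K t _ => Z (K₀ + K + 1) t - 0) δ ↔
      MatchingModConstants vol l₀ δ (fun K => Z (K₀ + K)) := by
  rw [core_oneTerm_iff]
  refine forall_congr' fun K => exists_congr fun c => forall_congr' fun t => forall_congr' fun ht => ?_
  dsimp only
  rw [← Nat.add_assoc]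
  exact ⟨abs_log_sub_le_of_sandwich (hZ _ t ht), sandwich_of_abs_log_sub_le (hZ _ t ht) (hZ _ t ht)⟩

/-- ★★ **THE ONE-TERM HYBRID DATUM ⟺ NODE U5's TARGET** (same remainder `δ`): for positive `Z`, `HybridNE7 l₀ vol univ A B ∅ 0 0 0 0 δ` at the one-term index ⟺
`Spine.NE7.Target vol l₀ δ (fun K ↦ Z (K₀ + K))` (`MatchingModConstants ∧ Summable δ`).  «⇒» with the remainder `hybridDelta vol δ 0` is the tree's `target_of_hybridNE7`;
here the weights vanish and the `Iff` is literal. [bookkeeping] -/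
theorem hybridNE7_oneTerm_iff_target (δ : ℕ → ℝ) (hZ : ∀ (K : ℕ) (t : ℝ), |t| ≤ l₀ → 0 < Z K t) :
    HybridNE7 l₀ vol (fun _ => (Finset.univ : Finset Unit)) (fun K t _ => Z (K₀ + K) t) (fun K t _ => Z (K₀ + K + 1) t) (fun _ _ => ∅) (fun _ => 0)
        (fun _ _ _ => 0) (fun _ _ _ => 0) (fun _ => 0) δ ↔ Target vol l₀ δ (fun K => Z (K₀ + K)) := by
  constructor
  · intro h
    exact ⟨(core_oneTerm_iff_matchingModConstants l₀ vol K₀ Z δ hZ).1 h.core, h.summable⟩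
  · rintro ⟨hM, hδ⟩
    exact hybridNE7_of_relWeightBound (relWeightBound_oneTerm l₀ K₀ Z) (shellWeightBound_oneTerm l₀ K₀ Z fun K t ht => (hZ K t ht).le)
      (fun _ => by norm_num) hδ ((core_oneTerm_iff_matchingModConstants l₀ vol K₀ Z δ hZ).2 hM)

end Generic

/-- **PER STRING: NODE U5's TARGET FROM `K₀` ON IS A `StringHybridNE7` DATUM** (the one-term witness `ι := Unit`; positivity of the dressed partition functions displayed —
`T4GenFunBounds.dressedZ_pos` discharges it for schemes with `β ≥ 0` and measurable observables bounded by `1`).  The converse of `T4MatchingAssembly.matchingModConstants_schemeZ`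
up to the remainder's name. [bookkeeping] -/
theorem stringHybridNE7_of_target {G : Type*} [GaugeGroup G] [MeasurableSpace G] [RegularGaugeGroup G] [HaarData G] {O : Type*}
    (S : Missing.TorusScheme G O) (os : List O) {l₀ vol : ℝ} {K₀ : ℕ} {δ : ℕ → ℝ}
    (hZ : ∀ (K : ℕ) (t : ℝ), |t| ≤ l₀ → 0 < T4GenFunBounds.schemeZ S os K t)
    (h : Target vol l₀ δ (fun K => T4GenFunBounds.schemeZ S os (K₀ + K))) : StringHybridNE7 S os l₀ vol K₀ := by
  refine ⟨Unit, inferInstance, fun _ => Finset.univ, fun K t _ => T4GenFunBounds.schemeZ S os (K₀ + K) t,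
    fun K t _ => T4GenFunBounds.schemeZ S os (K₀ + K + 1) t, fun _ _ _ => 0, fun _ _ _ => 0, fun _ _ => ∅, fun _ => 0, fun _ => 0, δ, ?_, ?_, ?_⟩
  · exact (hybridNE7_oneTerm_iff_target l₀ vol K₀ (T4GenFunBounds.schemeZ S os) δ hZ).2 h
  · exact fun K t _ => oneTerm_E1 K₀ (T4GenFunBounds.schemeZ S os) K t
  · exact fun K t _ => oneTerm_E2 K₀ (T4GenFunBounds.schemeZ S os) K t

/-! ## §2  As a carrier bundle `SpineCarriers` -/

/-- **THE ONE-TERM CARRIER BUNDLE** of `Z : ℕ → ℝ → ℝ` at radius `l₀`, volume letter `vol`, offset `K₀`: index `Unit`, one class per cutoff carrying `Z (K₀+K) t` (run A) ∕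
`Z (K₀+K+1) t` (run B), NO bad class, NO shells, weights `W = Wsh := 0`, rate field `δ := 0` (displayed; the K5 faces do not read it). [bookkeeping] -/
def oneTermCarriers (l₀ vol : ℝ) (K₀ : ℕ) (Z : ℕ → ℝ → ℝ) : SpineCarriers where
  ι := Unit
  dec := inferInstance
  l₀ := l₀
  vol := vol
  K₀ := K₀
  T := fun _ => Finset.univ
  A := fun K t _ => Z (K₀ + K) t
  B := fun K t _ => Z (K₀ + K + 1) t
  shA := fun _ _ _ => 0
  shB := fun _ _ _ => 0
  Bad := fun _ _ => ∅
  W := fun _ => 0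
  Wsh := fun _ => 0
  δ := fun _ => 0

section Carriers

variable (l₀ vol : ℝ) (K₀ : ℕ) (Z : ℕ → ℝ → ℝ)

/-- `ι` of the one-term bundle. [bookkeeping] -/
theorem oneTermCarriers_ι : (oneTermCarriers l₀ vol K₀ Z).ι = Unit := rfl
/-- `l₀` of the one-term bundle. [bookkeeping] -/
@[simp] theorem oneTermCarriers_l₀ : (oneTermCarriers l₀ vol K₀ Z).l₀ = l₀ := rfl
/-- `vol` of the one-term bundle. [bookkeeping] -/
@[simp] theorem oneTermCarriers_vol : (oneTermCarriers l₀ vol K₀ Z).vol = vol := rfl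
/-- `K₀` of the one-term bundle. [bookkeeping] -/
@[simp] theorem oneTermCarriers_K₀ : (oneTermCarriers l₀ vol K₀ Z).K₀ = K₀ := rfl
/-- `T` of the one-term bundle: the singleton class. [bookkeeping] -/
theorem oneTermCarriers_T : (oneTermCarriers l₀ vol K₀ Z).T = fun _ => (Finset.univ : Finset Unit) := rfl
/-- `A` of the one-term bundle: run A's whole partition function. [bookkeeping] -/
theorem oneTermCarriers_A : (oneTermCarriers l₀ vol K₀ Z).A = fun K t _ => Z (K₀ + K) t := rfl
/-- `B` of the one-term bundle: run B's whole partition function. [bookkeeping] -/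
theorem oneTermCarriers_B : (oneTermCarriers l₀ vol K₀ Z).B = fun K t _ => Z (K₀ + K + 1) t := rfl
/-- `Bad` of the one-term bundle is empty. [bookkeeping] -/
theorem oneTermCarriers_Bad : (oneTermCarriers l₀ vol K₀ Z).Bad = fun _ _ => ∅ := rfl
/-- `shA` of the one-term bundle is zero. [bookkeeping] -/
theorem oneTermCarriers_shA : (oneTermCarriers l₀ vol K₀ Z).shA = fun _ _ _ => 0 := rfl
/-- `shB` of the one-term bundle is zero. [bookkeeping] -/
theorem oneTermCarriers_shB : (oneTermCarriers l₀ vol K₀ Z).shB = fun _ _ _ => 0 := rfl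
/-- `W` of the one-term bundle is zero. [bookkeeping] -/
theorem oneTermCarriers_W : (oneTermCarriers l₀ vol K₀ Z).W = fun _ => 0 := rfl
/-- `Wsh` of the one-term bundle is zero. [bookkeeping] -/
theorem oneTermCarriers_Wsh : (oneTermCarriers l₀ vol K₀ Z).Wsh = fun _ => 0 := rfl
/-- `δ` of the one-term bundle is the displayed zero (unread by the faces). [bookkeeping] -/
theorem oneTermCarriers_δ : (oneTermCarriers l₀ vol K₀ Z).δ = fun _ => 0 := rfl

/-- N20 at the one-term bundle: OUTRIGHT. [bookkeeping] -/
theorem relWeightBound_oneTermCarriers :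
    RelWeightBound (oneTermCarriers l₀ vol K₀ Z).l₀ (oneTermCarriers l₀ vol K₀ Z).T (oneTermCarriers l₀ vol K₀ Z).A (oneTermCarriers l₀ vol K₀ Z).B
      (oneTermCarriers l₀ vol K₀ Z).Bad (oneTermCarriers l₀ vol K₀ Z).W :=
  relWeightBound_oneTerm l₀ K₀ Z

/-- N21 at the one-term bundle: OUTRIGHT given `0 ≤ Z` on the radius. [bookkeeping] -/
theorem shellWeightBound_oneTermCarriers (hZ : ∀ (K : ℕ) (t : ℝ), |t| ≤ l₀ → 0 ≤ Z K t) :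
    ShellWeightBound (oneTermCarriers l₀ vol K₀ Z).l₀ (oneTermCarriers l₀ vol K₀ Z).T (oneTermCarriers l₀ vol K₀ Z).A (oneTermCarriers l₀ vol K₀ Z).B
      (oneTermCarriers l₀ vol K₀ Z).shA (oneTermCarriers l₀ vol K₀ Z).shB (oneTermCarriers l₀ vol K₀ Z).Wsh :=
  shellWeightBound_oneTerm l₀ K₀ Z hZ

/-- U4′'s `W + Wsh < 1` at the one-term bundle: `0 + 0 < 1`. [bookkeeping] -/
theorem lt_one_oneTermCarriers (K : ℕ) : (oneTermCarriers l₀ vol K₀ Z).W K + (oneTermCarriers l₀ vol K₀ Z).Wsh K < 1 := by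
  simp only [oneTermCarriers_W, oneTermCarriers_Wsh, add_zero, zero_lt_one]

/-- ★★ **THE N19′ FACE AT THE ONE-TERM BUNDLE IS NODE U5's TARGET** (positive `Z`): `∃ δ, NE7.Core … δ ∧ Summable δ` at the bundle's carriers ⟺ `∃ δ, Target vol l₀ δ
(fun K ↦ Z (K₀ + K))`. [bookkeeping] -/
theorem core_oneTermCarriers_iff_target (hZ : ∀ (K : ℕ) (t : ℝ), |t| ≤ l₀ → 0 < Z K t) :
    (letI := (oneTermCarriers l₀ vol K₀ Z).dec
     ∃ δ : ℕ → ℝ, NE7.Core (oneTermCarriers l₀ vol K₀ Z).l₀ (oneTermCarriers l₀ vol K₀ Z).vol (oneTermCarriers l₀ vol K₀ Z).T (oneTermCarriers l₀ vol K₀ Z).Bad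
        (fun K t τ => (oneTermCarriers l₀ vol K₀ Z).A K t τ - (oneTermCarriers l₀ vol K₀ Z).shA K t τ)
        (fun K t τ => (oneTermCarriers l₀ vol K₀ Z).B K t τ - (oneTermCarriers l₀ vol K₀ Z).shB K t τ) δ ∧ Summable δ) ↔
      ∃ δ : ℕ → ℝ, Target vol l₀ δ (fun K => Z (K₀ + K)) :=
  exists_congr fun δ => and_congr_left' (core_oneTerm_iff_matchingModConstants l₀ vol K₀ Z δ hZ)

end Carriers

/-! ## §3  The off-live one-term reading at NODE 00's `CoPH`-keyed Stage-13 record -/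

variable {N : ℕ} [NeZero N]

/-- ★ **THE ONE-TERM READING AT THE STAGE-13 RECORD** (offset `K₀`): at every tuple `(F, θ, hP, g₀, os)` the one-term bundle of the tuple's OWN dressed partition functions
`schemeZ ((datumOfRecord₁₃CoPH F N θ hP).scheme g₀) os` at radius `1` and the physical volume letter `F.side ^ 4` (dag-n19-d DESIGN-POINT-VOL; unread by the faces here).
A legitimate value of K3⁷ v3's free spine reading OFF the live-selector line. [bookkeeping] -/
def crOneTerm₁₃ (K₀ : ℕ) : SpineReading₁₃CoPH N := fun F θ hP g₀ os =>
  oneTermCarriers 1 ((F.side : ℝ) ^ 4) K₀ (T4GenFunBounds.schemeZ ((datumOfRecord₁₃CoPH F N θ hP).scheme g₀) os)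

section Reading

variable {F : T4Family} (K₀ : ℕ) (θ : Stage13HParams F N) (hP : θ.Provisos₁₃CoPH F N) (g₀ : ℕ → ℝ) (os : List (ULoop F))

/-- The reading IS the one-term bundle of the tuple's partition functions (`rfl`). [bookkeeping] -/
theorem crOneTerm₁₃_eq : crOneTerm₁₃ K₀ F θ hP g₀ os =
    oneTermCarriers 1 ((F.side : ℝ) ^ 4) K₀ (T4GenFunBounds.schemeZ ((datumOfRecord₁₃CoPH F N θ hP).scheme g₀) os) := rfl

/-- **THE EXTRACTION FACE AT THE ONE-TERM READING HOLDS AT EVERY TUPLE AND EVERY `g₀`** — `0 < l₀`, `0 < vol`, E1 ∕ E2 by `Fintype.sum_unique`; NO selector pin, NO (H-U) ∕ (H-ζ) law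
(contrast dag-n20-d's `keyedExtraction_crOfRecord₁₃VAt`, a theorem exactly on the live line). [bookkeeping] -/
theorem extraction_crOneTerm₁₃ :
    0 < (crOneTerm₁₃ K₀ F θ hP g₀ os).l₀ ∧ 0 < (crOneTerm₁₃ K₀ F θ hP g₀ os).vol ∧
      (∀ (K : ℕ) (t : ℝ), |t| ≤ (crOneTerm₁₃ K₀ F θ hP g₀ os).l₀ →
        T4GenFunBounds.schemeZ ((datumOfRecord₁₃CoPH F N θ hP).scheme g₀) os ((crOneTerm₁₃ K₀ F θ hP g₀ os).K₀ + K) t =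
          ∑ τ ∈ (crOneTerm₁₃ K₀ F θ hP g₀ os).T K, (crOneTerm₁₃ K₀ F θ hP g₀ os).A K t τ) ∧
      (∀ (K : ℕ) (t : ℝ), |t| ≤ (crOneTerm₁₃ K₀ F θ hP g₀ os).l₀ →
        T4GenFunBounds.schemeZ ((datumOfRecord₁₃CoPH F N θ hP).scheme g₀) os ((crOneTerm₁₃ K₀ F θ hP g₀ os).K₀ + K + 1) t =
          ∑ τ ∈ (crOneTerm₁₃ K₀ F θ hP g₀ os).T K, (crOneTerm₁₃ K₀ F θ hP g₀ os).B K t τ) :=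
  ⟨one_pos, pow_pos F.side_pos 4, fun K t _ => oneTerm_E1 K₀ _ K t, fun K t _ => oneTerm_E2 K₀ _ K t⟩

/-- **N20 AT THE ONE-TERM READING: OUTRIGHT**, every tuple. [bookkeeping] -/
theorem relWeightBound_crOneTerm₁₃ :
    RelWeightBound (crOneTerm₁₃ K₀ F θ hP g₀ os).l₀ (crOneTerm₁₃ K₀ F θ hP g₀ os).T (crOneTerm₁₃ K₀ F θ hP g₀ os).A (crOneTerm₁₃ K₀ F θ hP g₀ os).B
      (crOneTerm₁₃ K₀ F θ hP g₀ os).Bad (crOneTerm₁₃ K₀ F θ hP g₀ os).W :=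
  relWeightBound_oneTermCarriers 1 _ K₀ _

/-- **N21 AT THE ONE-TERM READING: OUTRIGHT**, every tuple (the dressed partition functions of the datum of record are positive, `schemeZ_pos_datumOfRecord₁₃CoPH`).
[bookkeeping] -/
theorem shellWeightBound_crOneTerm₁₃ :
    ShellWeightBound (crOneTerm₁₃ K₀ F θ hP g₀ os).l₀ (crOneTerm₁₃ K₀ F θ hP g₀ os).T (crOneTerm₁₃ K₀ F θ hP g₀ os).A (crOneTerm₁₃ K₀ F θ hP g₀ os).B
      (crOneTerm₁₃ K₀ F θ hP g₀ os).shA (crOneTerm₁₃ K₀ F θ hP g₀ os).shB (crOneTerm₁₃ K₀ F θ hP g₀ os).Wsh :=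
  shellWeightBound_oneTermCarriers 1 _ K₀ _ fun K t _ => (schemeZ_pos_datumOfRecord₁₃CoPH θ hP g₀ os K t).le

/-- U4′'s `W + Wsh < 1` at the one-term reading. [bookkeeping] -/
theorem lt_one_crOneTerm₁₃ (K : ℕ) : (crOneTerm₁₃ K₀ F θ hP g₀ os).W K + (crOneTerm₁₃ K₀ F θ hP g₀ os).Wsh K < 1 :=
  lt_one_oneTermCarriers 1 _ K₀ _ K

/-- ★★ **THE N19′ FACE AT THE ONE-TERM READING IS NODE U5's TARGET AT THE DATUM**: `∃ δ, NE7.Core … δ ∧ Summable δ` at the reading's carriers ⟺ `∃ δ, Target (F.side ^ 4) 1 δ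
(fun K ↦ schemeZ ((datumOfRecord₁₃CoPH F N θ hP).scheme g₀) os (K₀ + K))` — matching of the consecutive dressed partition functions of record modulo `t`-independent
constants on `|t| ≤ 1`, summable remainder.  NOT PRINTED for `d = 4`, NOT proved; displayed. [bookkeeping] -/
theorem core_crOneTerm₁₃_iff_target :
    (letI := (crOneTerm₁₃ K₀ F θ hP g₀ os).dec
     ∃ δ : ℕ → ℝ, NE7.Core (crOneTerm₁₃ K₀ F θ hP g₀ os).l₀ (crOneTerm₁₃ K₀ F θ hP g₀ os).vol (crOneTerm₁₃ K₀ F θ hP g₀ os).T (crOneTerm₁₃ K₀ F θ hP g₀ os).Bad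
        (fun K t τ => (crOneTerm₁₃ K₀ F θ hP g₀ os).A K t τ - (crOneTerm₁₃ K₀ F θ hP g₀ os).shA K t τ)
        (fun K t τ => (crOneTerm₁₃ K₀ F θ hP g₀ os).B K t τ - (crOneTerm₁₃ K₀ F θ hP g₀ os).shB K t τ) δ ∧ Summable δ) ↔
      ∃ δ : ℕ → ℝ, Target ((F.side : ℝ) ^ 4) 1 δ (fun K => T4GenFunBounds.schemeZ ((datumOfRecord₁₃CoPH F N θ hP).scheme g₀) os (K₀ + K)) :=
  core_oneTermCarriers_iff_target 1 _ K₀ _ fun K t _ => schemeZ_pos_datumOfRecord₁₃CoPH θ hP g₀ os K t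

end Reading

/-! ## §4  dag-n27-c's VCut OFF-LIVE binders at `cr' := crOneTerm₁₃ K₀` (`N = 2`; guard ∧ `¬ LiveSel`), in their exact shapes -/

section OffLive

variable (K₀ : ℕ)

/-- **`h20'` AT THE ONE-TERM READING — FREE** (the guard, the off-live clause and admissibility are not read). [bookkeeping] -/
theorem h20_shape_crOneTerm₁₃ :
    ∀ (F : T4Family) (θ : Stage13HParams F 2) (hP : θ.Provisos₁₃CoPH F 2),
      ((θ.ZhUnity F 2 ∧ θ.SlotsNondegenerate₁₃ F 2) ∧ ¬ θ.ppSel = ppSelLiveOfRecord F 2 θ.ν θ.τ9 (EOfRecord₁₃ F 2 θ.toStage13Params) (wOfRecord₉ F 2 θ.toStage9Params)) →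
      θ.Admissible F 2 → ∀ (g₀ : ℕ → ℝ) (os : List (ULoop F)),
        RelWeightBound (crOneTerm₁₃ K₀ F θ hP g₀ os).l₀ (crOneTerm₁₃ K₀ F θ hP g₀ os).T (crOneTerm₁₃ K₀ F θ hP g₀ os).A (crOneTerm₁₃ K₀ F θ hP g₀ os).B
          (crOneTerm₁₃ K₀ F θ hP g₀ os).Bad (crOneTerm₁₃ K₀ F θ hP g₀ os).W :=
  fun _ θ hP _ _ g₀ os => relWeightBound_crOneTerm₁₃ K₀ θ hP g₀ os

/-- **`h21'` AT THE ONE-TERM READING — FREE**. [bookkeeping] -/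
theorem h21_shape_crOneTerm₁₃ :
    ∀ (F : T4Family) (θ : Stage13HParams F 2) (hP : θ.Provisos₁₃CoPH F 2),
      ((θ.ZhUnity F 2 ∧ θ.SlotsNondegenerate₁₃ F 2) ∧ ¬ θ.ppSel = ppSelLiveOfRecord F 2 θ.ν θ.τ9 (EOfRecord₁₃ F 2 θ.toStage13Params) (wOfRecord₉ F 2 θ.toStage9Params)) →
      θ.Admissible F 2 → ∀ (g₀ : ℕ → ℝ) (os : List (ULoop F)),
        ShellWeightBound (crOneTerm₁₃ K₀ F θ hP g₀ os).l₀ (crOneTerm₁₃ K₀ F θ hP g₀ os).T (crOneTerm₁₃ K₀ F θ hP g₀ os).A (crOneTerm₁₃ K₀ F θ hP g₀ os).B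
          (crOneTerm₁₃ K₀ F θ hP g₀ os).shA (crOneTerm₁₃ K₀ F θ hP g₀ os).shB (crOneTerm₁₃ K₀ F θ hP g₀ os).Wsh :=
  fun _ θ hP _ _ g₀ os => shellWeightBound_crOneTerm₁₃ K₀ θ hP g₀ os

/-- **`hx'` AT THE ONE-TERM READING — FREE** (every `g₀`: `ForSmallCouplings.of_forall`; (B) and END unread). [bookkeeping] -/
theorem hx_shape_crOneTerm₁₃ :
    ∀ (F : T4Family) (θ : Stage13HParams F 2) (hP : θ.Provisos₁₃CoPH F 2),
      ((θ.ZhUnity F 2 ∧ θ.SlotsNondegenerate₁₃ F 2) ∧ ¬ θ.ppSel = ppSelLiveOfRecord F 2 θ.ν θ.τ9 (EOfRecord₁₃ F 2 θ.toStage13Params) (wOfRecord₉ F 2 θ.toStage9Params)) →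
      θ.Admissible F 2 → B16.EndStatementBPrinted (datumOfRecord₁₃CoPH F 2 θ hP).C → DagBinding.EndpointExistence (datumOfRecord₁₃CoPH F 2 θ hP).C.toB12 →
        ForSmallCouplings (datumOfRecord₁₃CoPH F 2 θ hP) fun g₀ => ∀ os : List (ULoop F),
          0 < (crOneTerm₁₃ K₀ F θ hP g₀ os).l₀ ∧ 0 < (crOneTerm₁₃ K₀ F θ hP g₀ os).vol ∧
          (∀ (K : ℕ) (t : ℝ), |t| ≤ (crOneTerm₁₃ K₀ F θ hP g₀ os).l₀ →
            T4GenFunBounds.schemeZ ((datumOfRecord₁₃CoPH F 2 θ hP).scheme g₀) os ((crOneTerm₁₃ K₀ F θ hP g₀ os).K₀ + K) t =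
              ∑ τ ∈ (crOneTerm₁₃ K₀ F θ hP g₀ os).T K, (crOneTerm₁₃ K₀ F θ hP g₀ os).A K t τ) ∧
          (∀ (K : ℕ) (t : ℝ), |t| ≤ (crOneTerm₁₃ K₀ F θ hP g₀ os).l₀ →
            T4GenFunBounds.schemeZ ((datumOfRecord₁₃CoPH F 2 θ hP).scheme g₀) os ((crOneTerm₁₃ K₀ F θ hP g₀ os).K₀ + K + 1) t =
              ∑ τ ∈ (crOneTerm₁₃ K₀ F θ hP g₀ os).T K, (crOneTerm₁₃ K₀ F θ hP g₀ os).B K t τ) :=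
  fun _ θ hP _ _ _ _ => ForSmallCouplings.of_forall fun g₀ os => extraction_crOneTerm₁₃ K₀ θ hP g₀ os

/-- ★★ **`h19'` AT THE ONE-TERM READING FROM NODE U5's TARGET AT THE DATUM**: for ANY rates predicate `P` at any rate reading `rr`, IF on the off-live guarded admissible tuples the
rates imply `∃ δ, Target (F.side^4) 1 δ (fun K ↦ schemeZ ((datumOfRecord₁₃CoPH F 2 θ hP).scheme g₀) os (K₀ + K))` — DISPLAYED, NOT PRINTED, NOT proved — then leaf D's core
binder holds at `cr' := crOneTerm₁₃ K₀` there.  Together with `h20' ∕ h21' ∕ hx'` above: OFF THE LIVE LINE STUB 2's FOUR FACES AT THE ONE-TERM READING = NODE U5's TARGET AT THE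
DATUM, GIVEN THE RATES. [bookkeeping] -/
theorem h19_shape_crOneTerm₁₃_of_target
    (rr : (F : T4Family) → (θ : Stage13HParams F 2) → θ.Provisos₁₃CoPH F 2 → (ℕ → ℝ) → List (ULoop F) → RateCarriers 2)
    (P : ∀ {F : T4Family}, Datum F 2 → RateCarriers 2 → Prop)
    (htarget : ∀ (F : T4Family) (θ : Stage13HParams F 2) (hP : θ.Provisos₁₃CoPH F 2),
      ((θ.ZhUnity F 2 ∧ θ.SlotsNondegenerate₁₃ F 2) ∧ ¬ θ.ppSel = ppSelLiveOfRecord F 2 θ.ν θ.τ9 (EOfRecord₁₃ F 2 θ.toStage13Params) (wOfRecord₉ F 2 θ.toStage9Params)) →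
      θ.Admissible F 2 → ∀ (g₀ : ℕ → ℝ) (os : List (ULoop F)), P (datumOfRecord₁₃CoPH F 2 θ hP) (rr F θ hP g₀ os) →
        ∃ δ : ℕ → ℝ, Target ((F.side : ℝ) ^ 4) 1 δ (fun K => T4GenFunBounds.schemeZ ((datumOfRecord₁₃CoPH F 2 θ hP).scheme g₀) os (K₀ + K))) :
    ∀ (F : T4Family) (θ : Stage13HParams F 2) (hP : θ.Provisos₁₃CoPH F 2),
      ((θ.ZhUnity F 2 ∧ θ.SlotsNondegenerate₁₃ F 2) ∧ ¬ θ.ppSel = ppSelLiveOfRecord F 2 θ.ν θ.τ9 (EOfRecord₁₃ F 2 θ.toStage13Params) (wOfRecord₉ F 2 θ.toStage9Params)) →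
      θ.Admissible F 2 → ∀ (g₀ : ℕ → ℝ) (os : List (ULoop F)),
        P (datumOfRecord₁₃CoPH F 2 θ hP) (rr F θ hP g₀ os) → letI := (crOneTerm₁₃ K₀ F θ hP g₀ os).dec
          ∃ δ : ℕ → ℝ, NE7.Core (crOneTerm₁₃ K₀ F θ hP g₀ os).l₀ (crOneTerm₁₃ K₀ F θ hP g₀ os).vol (crOneTerm₁₃ K₀ F θ hP g₀ os).T (crOneTerm₁₃ K₀ F θ hP g₀ os).Bad
            (fun K t τ => (crOneTerm₁₃ K₀ F θ hP g₀ os).A K t τ - (crOneTerm₁₃ K₀ F θ hP g₀ os).shA K t τ)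
            (fun K t τ => (crOneTerm₁₃ K₀ F θ hP g₀ os).B K t τ - (crOneTerm₁₃ K₀ F θ hP g₀ os).shB K t τ) δ ∧ Summable δ :=
  fun F θ hP hRg hθ g₀ os hPr => (core_crOneTerm₁₃_iff_target K₀ θ hP g₀ os).2 (htarget F θ hP hRg hθ g₀ os hPr)

end OffLive

end Summit.QuantumFields.YangMills.BalabanUVNodes.N20OffLiveOneTermReading

end
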